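import Summits.BirchSwinnertonDyer.BirchSwinnertonDyer.Theorems.EisensteinPrimesMazurMCOnCellBTwistbackSubrowPartnerGiven
import Summits.BirchSwinnertonDyer.BirchSwinnertonDyer.Theorems.EisensteinPrimesMultOrderOnePAdicGZ
import HarnessLib

/-!
# Crux 3 `MazurMCOnCellB` (stmt-BirchSwinnertonDyer-19033), line `twistback` v5 — the sub-row doors WITHOUT Keller–Yin:
# part 1, the KL-flat door and the two `K`-given doors `_of_padicGZ` (Disegni 2020 Thm. 2.4 in place of Thm. E)

Width seat bsd-line-x2-p1-w3 (g11), 2026-08-28; sequel of `…EisensteinPrimesMultOrderOnePAdicGZ` (this seat) over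
`…TwistbackLamOnePartner` (w5, p650387) and `…TwistbackSubrowPartnerGiven` (LEAD g11, p655083). HONEST FRAMING (cell
`bsd-eis`, run/shared/lean/pub/bsd-eis/): conditional theorems only. Named facts BY NAME: the route's `PublishedInputs`
(stmt-…-19037: modularity, Hoffstein–Luo, Gross–Zagier, Wuthrich Thm. 16 …), Disegni 2020 Thm. 4(1)
(`padicBSD_rankOne_nonsplitMult`, PUB), Greenberg–Vatsal Thm. (3.11) (`h311`, PUB) and Disegni 2020 Thm. 2.4
(`padicGrossZagier_nonsplitMult`, PUB, `Literature/…/Disegni2020/PAdicGrossZagierNonsplit.lean`, this seat) — and NOTHING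
unrefereed: every theorem below is the `_of_thmE` theorem of the same name in the LEAD's chain with the hypotheses
`hDD` (Dokchitser–Dokchitser Thm. 1.4) and `hKY` (Keller–Yin arXiv:2402.12781 Thm. E, PRE) REPLACED by the single
`hDGZ`. No `def`, no `sorry`; nothing about any curve is proved unconditionally; no main conjecture / BSD; 0 cells /
labels / stubs / tiers move; no reshape is filed (W-79: the LEAD decides whether `upperPartner_onSubrow` switches doors and
`stub_kellerYinThmDE` ↦ `stub_thmD`).

* §1 `upperPartner_at_of_klFlat_partner_of_padicGZ` — p650387's door (`…LamOnePartner.upperPartner_at_of_klFlat_partner_of_thmE`)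
  VERBATIM, the partner's analytic rank now DERIVED by `…MultOrderOnePAdicGZ.analyticRank_eq_one_of_analyticLambdaEq_one_of_padicGZ`
  (Perrin-Riou's argument with Disegni's `p`-adic Gross–Zagier formula) instead of «corank ≤ 1 + parity + Thm. E».
* §2 `upperPartner_at_of_{ramifiedOdd,unramifiedEven}_of_classNumber_of_padicGZ` — LEAD g11's `K`-given doors
  (`…SubrowPartnerGiven.…_of_classNumber_of_thmE`) VERBATIM over §1.

References: [Disegni2020] §2.2 Thm. 2.4, §3.2 Thm. 4; [GreenbergVatsal2000] §3 Thm. (3.11); [Wuthrich2014] Thm. 16;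
[PerrinRiou1987] §1.4; [GrossZagier1986] Thm. I.6.3; [HoffsteinLuo1997] Theorem; [SilvermanAEC2009] VIII.8 Cor. 8.3.
-/

set_option autoImplicit false

-- `Summit.BirchSwinnertonDyer.BirchSwinnertonDyer.…`: the summit and its single sub-problem share a name.
set_option linter.dupNamespace false

noncomputable section

open scoped Classical MatrixGroups ModularForm NumberTheorySymbols

open CongruenceSubgroup WeierstrassCurve NumberField IsDedekindDomain Field PowerSeries DirichletCharacter
  Rat.HeightOneSpectrum
  Literature.NumberTheory.EllipticCurves
  Literature.NumberTheory.GaloisRepresentations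
  Literature.NumberTheory.EllipticCurves.ModularForms
  Literature.NumberTheory.QuadraticFields
  Literature.NumberTheory.EllipticCurves.Rank1Residual
  Literature.NumberTheory.EllipticCurves.Rank1Residual.Typed
  Literature.NumberTheory.EllipticCurves.Wuthrich2014
  Literature.NumberTheory.EllipticCurves.GreenbergVatsal2000
  Literature.NumberTheory.EllipticCurves.Disegni2020
  Summit.BirchSwinnertonDyer.Rank1Residual
  Summit.BirchSwinnertonDyer.Rank1Residual.X2
  Summit.BirchSwinnertonDyer.Rank1Residual.X2.IsogenyQuotientLine
  Summit.BirchSwinnertonDyer.BirchSwinnertonDyer.Theses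
  Summit.BirchSwinnertonDyer.BirchSwinnertonDyer.Theorems.EisensteinPrimesLambdaFromCharacters
  Summit.BirchSwinnertonDyer.BirchSwinnertonDyer.Theorems.EisensteinPrimesMazurMCOnCellBTwistbackKLFlatPartner
  Summit.BirchSwinnertonDyer.BirchSwinnertonDyer.Theorems.EisensteinPrimesMazurMCOnCellBTwistbackLamOneRankOne
  Summit.BirchSwinnertonDyer.BirchSwinnertonDyer.Theorems.EisensteinPrimesMazurMCOnCellBTwistbackSubrowCarrier
  Summit.BirchSwinnertonDyer.BirchSwinnertonDyer.Theorems.EisensteinPrimesMazurMCOnCellBTwistbackSubrowCarrierEven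
  Summit.BirchSwinnertonDyer.BirchSwinnertonDyer.Theorems.EisensteinPrimesMazurMCOnCellBTwistbackSubrowPartnerGiven
  Summit.BirchSwinnertonDyer.BirchSwinnertonDyer.Theorems.EisensteinPrimesMultOrderOnePAdicGZ

namespace Summit.BirchSwinnertonDyer.BirchSwinnertonDyer.Theorems.EisensteinPrimesMazurMCOnCellBTwistbackSubrowPartnerGivenPAdicGZ

/-! ## §1. Road (d′), the DOOR, PUBLISHED inputs only -/

/-- **Stub 6's conclusion AT ONE X2b pair (VERBATIM shape) from a KL-FLAT PARTNER, the partner's analytic rank being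
DERIVED from PUBLISHED inputs** — `…LamOnePartner.upperPartner_at_of_klFlat_partner_of_thmE` (p650387) with `hDD` + `hKY`
REPLACED by `hDGZ : padicGrossZagier_nonsplitMult` (Disegni 2020 Thm. 2.4): for a NON-split X2b pair `(W, p)` and ONE
admissible `K` such that every globally minimal model `Wd` of `E^{(d_K)}` has a KL-FLAT CARRIER (`V′` isogenous to
`Wd`, ramified-even rational line, primitive `φ`, `ψ`, unit `L`-values, local balance `1`), the partner clause holds at
`(W, p)` with this `K`. Route: F1 (`…LambdaFromCharacters`, GV Thm. (3.11) + Wuthrich) gives `(μ_an, λ_an)(V′) = (0,1)`;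
`r_an(V′) = r_an(E^{(d_K)})` is odd (`r_an(E) = 0`, Heegner sign); `…MultOrderOnePAdicGZ` §3 (Perrin-Riou's argument
with Disegni's `p`-adic Gross–Zagier formula and Hoffstein–Luo / Gross–Zagier from `PublishedInputs`) gives
`r_an(V′) = 1`; then p645525 §3 verbatim. [cite: Disegni2020, §2.2 Thm. 2.4 and §3.2 Thm. 4]
[cite: GreenbergVatsal2000, §3 Thm. (3.11) (p. 43) and §2 p. 28] [cite: Wuthrich2014, Thm. 16 (p. 397)]
[cite: PerrinRiou1987, §1.4 Cor. 1.8] [cite: SilvermanAEC2009, VIII.8 Cor. 8.3] -/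
theorem upperPartner_at_of_klFlat_partner_of_padicGZ (hP : EisensteinPrimes.PublishedInputs)
    (hDis : padicBSD_rankOne_nonsplitMult) (h311 : thm311_hasUnitContent_iff_and_order_eq_of_lineRamifiedEven)
    (hDGZ : padicGrossZagier_nonsplitMult)
    (W : WeierstrassCurve ℚ) [W.IsElliptic] [W.IsGloballyMinimal] (p : ℕ) [Fact p.Prime]
    (hc : X2.CellB W p) (hns : ¬ W.HasSplitMultiplicativeReductionAtPrime p)
    (K : Type) [Field K] [NumberField K] (hK : IsImaginaryQuadratic K)
    (hHN : SatisfiesHeegnerHypothesis (W.conductorNorm ℤ) K) (hHp : SatisfiesHeegnerHypothesis p K)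
    (hodd : Odd (NumberField.discr K)) (hlt : NumberField.discr K < -4)
    (hKL : ∀ (Wd : WeierstrassCurve ℚ) [Wd.IsElliptic] [Wd.IsGloballyMinimal],
      (∃ C : VariableChange ℚ, C • Wd = W.quadraticTwist (NumberField.discr K : ℚ)) →
      ∃ (V' : WeierstrassCurve ℚ) (_ : V'.IsElliptic) (_ : V'.IsGloballyMinimal), IsIsogenous Wd V' ∧
        ∃ (S₀ : Finset (HeightOneSpectrum (𝓞 ℚ))) (Φ₀ : AddSubgroup (V'.geomTorsion (p : ℤ)))
          (m : ℕ) (_ : NeZero m) (φ : DirichletCharacter (ZMod p) m)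
          (d : ℕ) (_ : NeZero d) (ψ : DirichletCharacter (ZMod p) d),
          IsRationalLine V' p Φ₀ ∧ ¬ LineUnramifiedAt V' p Φ₀ ∧ LineEven V' p Φ₀ ∧
          φ.IsPrimitive ∧ ψ.IsPrimitive ∧ p ∣ m ∧ ¬ p ∣ d ∧
          (∀ (σ : absoluteGaloisGroup ℚ), ∀ Q ∈ Φ₀,
            σ • Q = (φ ((modNCyclotomicCharacter ℚ m σ : (ZMod m)ˣ) : ZMod m)).val • Q) ∧
          (∀ (σ : absoluteGaloisGroup ℚ) (Q : V'.geomTorsion (p : ℤ)),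
            σ • Q - (ψ ((modNCyclotomicCharacter ℚ d σ : (ZMod d)ˣ) : ZMod d)).val • Q ∈ Φ₀) ∧
          (∀ v ∈ S₀, ((p : ℕ) : 𝓞 ℚ) ∉ v.asIdeal) ∧
          (∀ v : HeightOneSpectrum (𝓞 ℚ), v ∉ S₀ → ((p : ℕ) : 𝓞 ℚ) ∉ v.asIdeal →
            V'.HasGoodReductionAt v) ∧
          ‖characterLValueC p φ ∅ 1‖ = 1 ∧ ‖characterLValueD p ψ ∅ 1‖ = 1 ∧
          1 + ∑ v ∈ S₀, delta V' p v =
            ∑ v ∈ S₀, ((if φ (Rat.HeightOneSpectrum.natGenerator v : ZMod m) =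
                  (Rat.HeightOneSpectrum.natGenerator v : ZMod p)
                then sFactor p (Rat.HeightOneSpectrum.natGenerator v) else 0) +
              (if ψ (Rat.HeightOneSpectrum.natGenerator v : ZMod d) =
                  (Rat.HeightOneSpectrum.natGenerator v : ZMod p)
                then sFactor p (Rat.HeightOneSpectrum.natGenerator v) else 0))) :
    ∃ (K : Type) (_ : Field K) (_ : NumberField K), IsImaginaryQuadratic K ∧
      SatisfiesHeegnerHypothesis (W.conductorNorm ℤ) K ∧ SatisfiesHeegnerHypothesis p K ∧
      Odd (NumberField.discr K) ∧ NumberField.discr K < -4 ∧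
      (W.quadraticTwist (NumberField.discr K : ℚ)).analyticRank = 1 ∧
      ∀ (Wd : WeierstrassCurve ℚ) [Wd.IsElliptic] [Wd.IsGloballyMinimal],
        (∃ C : VariableChange ℚ, C • Wd = W.quadraticTwist (NumberField.discr K : ℚ)) →
        MissingUpperBoundAt Wd p := by
  have hpar := hP.2.2.2.2.1
  have hnf := hP.2.2.2.2.2.1
  have hHL := hP.2.2.2.2.2.2.1
  have hGZ := hP.2.2.2.2.2.2.2.2.1
  have hWu := hP.2.2.2.2.2.2.2.2.2.2.2.2.2.2.1
  have hp2 : p ≠ 2 := hc.2.1.1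
  have hmult : W.HasMultiplicativeReductionAtPrime p := hc.2.1.2.2
  have hr0 : W.analyticRank = 0 := hc.1
  have hdK : (NumberField.discr K : ℚ) ≠ 0 := by exact_mod_cast NumberField.discr_ne_zero K
  haveI := W.isElliptic_quadraticTwist hdK
  -- a globally minimal model `Wd` of the twist (Silverman VIII.8.3) and its KL-flat carrier `V'`
  obtain ⟨C₀, hC₀⟩ := hasGlobalMinimalModel_rat_holds (W.quadraticTwist (NumberField.discr K : ℚ))
  set Wd : WeierstrassCurve ℚ := C₀ • W.quadraticTwist (NumberField.discr K : ℚ) with hWd_def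
  haveI : Wd.IsGloballyMinimal := hC₀
  have hWd : ∃ C : VariableChange ℚ, C • Wd = W.quadraticTwist (NumberField.discr K : ℚ) :=
    ⟨C₀⁻¹, inv_smul_smul C₀ _⟩
  obtain ⟨V', _, _, hiso, S₀, Φ₀, m, _, φ, d, _, ψ, hΦ, hram, heven, hφ, hψ, hpm, hpd, hφ0, hψ0, hS₀p, hS,
    hC1, hD1, hbal⟩ := hKL Wd hWd
  -- the carrier is NON-split multiplicative at `p` with `E[p]` reducible
  obtain ⟨C, hC⟩ := hWd
  have hXd : ClassX2 Wd p := X2.classX2_twist W p hc.2.1 K hK hHp Wd ⟨C, hC⟩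
  have hnsd : ¬ Wd.HasSplitMultiplicativeReductionAtPrime p := fun hs ↦
    hns ((X2.hasSplitMultiplicativeReductionAtPrime_iff_of_smul_eq_quadraticTwist W Wd hK p hp2 hmult hHp
      hC).mp hs)
  have hmult' : V'.HasMultiplicativeReductionAtPrime p :=
    hasMultiplicativeReductionAtPrime_of_isIsogenous hiso hXd.2.2
  have hns' : ¬ V'.HasSplitMultiplicativeReductionAtPrime p := fun hs ↦
    hnsd ((hasSplitMultiplicativeReductionAtPrime_iff_of_isIsogenous (p := p) hiso).mpr hs)
  have hred' : ¬ V'.HasIrreducibleModPGaloisRep p := not_hasIrreducibleModPGaloisRep_of_isRationalLine hΦ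
  -- F1: the two-engine certificate `(μ_an, λ_an)(V', p) = (0, 1)` from the KL-flat character data
  obtain ⟨hμ, hlam⟩ := analyticMuLE_zero_and_analyticLambdaEq_of_lineRamifiedEven_of_klFlat V' p h311 hWu S₀ Φ₀
    m φ d ψ hp2 hmult' hΦ hram heven hφ hψ hpm hpd hφ0 hψ0 hS₀p hS hC1 hD1 1 hbal
  -- the analytic rank of the carrier is odd: `r_an(V') = r_an(Wd) = r_an(E^{(d_K)})`
  have hrd : Wd.analyticRank = (W.quadraticTwist (NumberField.discr K : ℚ)).analyticRank := by
    have h := congrArg WeierstrassCurve.analyticRank hC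
    rwa [analyticRank_smul] at h
  have hrV : V'.analyticRank = (W.quadraticTwist (NumberField.discr K : ℚ)).analyticRank := by
    rw [← analyticRank_eq_of_isIsogenous' hiso, hrd]
  have hoddV : Odd V'.analyticRank := by
    rw [hrV]
    exact odd_analyticRank_quadraticTwist_of_analyticRank_eq_zero hnf W hr0 K hK hHN
  -- `…MultOrderOnePAdicGZ` §3 (Perrin-Riou + Disegni): `r_an(V') = 1`, hence `r_an(E^{(d_K)}) = 1`
  have hr1' : V'.analyticRank = 1 :=
    EisensteinPrimesMultOrderOnePAdicGZ.analyticRank_eq_one_of_analyticLambdaEq_one_of_padicGZ hWu hpar hnf hHL hGZ hDGZ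
      V' p hp2 hmult' hns' hred' hoddV hμ hlam
  have hr1 : (W.quadraticTwist (NumberField.discr K : ℚ)).analyticRank = 1 := by rw [← hrV, hr1']
  -- road (d)'s door with `hr1` discharged
  exact upperPartner_at_of_klFlat_partner hP hDis h311 W p hc hns K hK hHN hHp hodd hlt hr1 hKL

/-! ## §2. The `K`-given doors (both X2b shapes), PUBLISHED inputs only -/

section Given

variable (W : WeierstrassCurve ℚ) [W.IsElliptic] [W.IsGloballyMinimal] (p : ℕ) [Fact p.Prime]

/-- **Stub 6 (∃-PARTNER) AT `(W, p)`, FIRST shape (line ramified-odd), the analytic rank DERIVED from PUBLISHED inputs**: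
LEAD g11's `…SubrowPartnerGiven.upperPartner_at_of_ramifiedOdd_of_classNumber_of_thmE` with `hDD` + `hKY` REPLACED by
`hDGZ` — part 1's carrier (`exists_klFlatCarrier_twist_of_ramifiedOdd`) into §1. Inputs BY NAME: `PublishedInputs`,
Disegni Thm. 4(1), GV Thm. (3.11), Disegni Thm. 2.4 (all PUB). [cite: Disegni2020, §2.2 Thm. 2.4 and §3.2 Thm. 4]
[cite: GreenbergVatsal2000, §3 Thm. (3.11) (p. 43)] [cite: Wuthrich2014, Thm. 16 (p. 397)] -/
theorem upperPartner_at_of_ramifiedOdd_of_classNumber_of_padicGZ (hP : EisensteinPrimes.PublishedInputs)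
    (hDis : padicBSD_rankOne_nonsplitMult) (h311 : thm311_hasUnitContent_iff_and_order_eq_of_lineRamifiedEven)
    (hDGZ : padicGrossZagier_nonsplitMult)
    (hc : X2.CellB W p) (hns : ¬ W.HasSplitMultiplicativeReductionAtPrime p)
    {Φ₀ : AddSubgroup (geomTorsion W (p : ℤ))} (hΦ : IsRationalLine W p Φ₀)
    (hram : ¬ LineUnramifiedAt W p Φ₀) (hodd : LineOdd W p Φ₀)
    {m : ℕ} [NeZero m] (φ : DirichletCharacter (ZMod p) m) {d : ℕ} [NeZero d]
    (ψ : DirichletCharacter (ZMod p) d) (hφ : φ.IsPrimitive) (hψ : ψ.IsPrimitive) (hpm : p ∣ m)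
    (hpd : ¬ p ∣ d) (hquad : ψ.IsQuadratic)
    (hφ0 : ∀ (σ : absoluteGaloisGroup ℚ), ∀ P ∈ Φ₀,
      σ • P = (φ ((modNCyclotomicCharacter ℚ m σ : (ZMod m)ˣ) : ZMod m)).val • P)
    (hψ0 : ∀ (σ : absoluteGaloisGroup ℚ) (P : geomTorsion W (p : ℤ)),
      σ • P - (ψ ((modNCyclotomicCharacter ℚ d σ : (ZMod d)ˣ) : ZMod d)).val • P ∈ Φ₀)
    (S₀ : Finset (HeightOneSpectrum (𝓞 ℚ))) (hS₀p : ∀ v ∈ S₀, ((p : ℕ) : 𝓞 ℚ) ∉ v.asIdeal)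
    (hS : ∀ v : HeightOneSpectrum (𝓞 ℚ), v ∉ S₀ → ((p : ℕ) : 𝓞 ℚ) ∉ v.asIdeal → W.HasGoodReductionAt v)
    (hbal : 1 + ∑ v ∈ S₀, delta W p v =
      ∑ v ∈ S₀, ((if φ (Rat.HeightOneSpectrum.natGenerator v : ZMod m) =
            (Rat.HeightOneSpectrum.natGenerator v : ZMod p)
          then sFactor p (Rat.HeightOneSpectrum.natGenerator v) else 0) +
        (if ψ (Rat.HeightOneSpectrum.natGenerator v : ZMod d) =
            (Rat.HeightOneSpectrum.natGenerator v : ZMod p)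
          then sFactor p (Rat.HeightOneSpectrum.natGenerator v) else 0)))
    (K : Type) [Field K] [NumberField K] (hK : IsImaginaryQuadratic K)
    (hHN : SatisfiesHeegnerHypothesis (W.conductorNorm ℤ) K) (hHp : SatisfiesHeegnerHypothesis p K)
    (hoddK : Odd (NumberField.discr K)) (hlt : NumberField.discr K < -4)
    {N₀ : ℕ} (hHN₀ : SatisfiesHeegnerHypothesis N₀ K)
    (hS₀N₀ : ∀ v ∈ S₀, Rat.HeightOneSpectrum.natGenerator v ∣ N₀)
    (hmK : m.Coprime (NumberField.discr K).natAbs) (hdK : d.Coprime (NumberField.discr K).natAbs)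
    (hh : ¬ p ∣ BinaryQuadraticForm.classNumber (-((d * (NumberField.discr K).natAbs : ℕ) : ℤ))) :
    ∃ (K : Type) (_ : Field K) (_ : NumberField K), IsImaginaryQuadratic K ∧
      SatisfiesHeegnerHypothesis (W.conductorNorm ℤ) K ∧ SatisfiesHeegnerHypothesis p K ∧
      Odd (NumberField.discr K) ∧ NumberField.discr K < -4 ∧
      (W.quadraticTwist (NumberField.discr K : ℚ)).analyticRank = 1 ∧
      ∀ (Wd : WeierstrassCurve ℚ) [Wd.IsElliptic] [Wd.IsGloballyMinimal],
        (∃ C : VariableChange ℚ, C • Wd = W.quadraticTwist (NumberField.discr K : ℚ)) →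
        MissingUpperBoundAt Wd p :=
  upperPartner_at_of_klFlat_partner_of_padicGZ hP hDis h311 hDGZ W p hc hns K hK hHN hHp hoddK hlt
    (exists_klFlatCarrier_twist_of_ramifiedOdd W p hc.2.1 hns hΦ hram hodd φ ψ hφ hψ hpm hpd hquad hφ0 hψ0 S₀ hS₀p
      hS hbal K hK hHp (discr_emod_four_eq_one_of_odd hK.1 hoddK) hlt hHN₀ hS₀N₀ hmK hdK hh)

/-- **Stub 6 (∃-PARTNER) AT `(W, p)`, SECOND shape (line unramified-even), the analytic rank DERIVED from PUBLISHED
inputs**: LEAD g11's `…SubrowPartnerGiven.upperPartner_at_of_unramifiedEven_of_classNumber_of_thmE` with `hDD` + `hKY`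
REPLACED by `hDGZ` — part 2's carrier (`exists_klFlatCarrier_twist_of_unramifiedEven`) into §1.
[cite: Disegni2020, §2.2 Thm. 2.4 and §3.2 Thm. 4] [cite: GreenbergVatsal2000, §3 Thm. (3.11) and §2 p. 28]
[cite: Wuthrich2014, Thm. 16 (p. 397)] -/
theorem upperPartner_at_of_unramifiedEven_of_classNumber_of_padicGZ (hP : EisensteinPrimes.PublishedInputs)
    (hDis : padicBSD_rankOne_nonsplitMult) (h311 : thm311_hasUnitContent_iff_and_order_eq_of_lineRamifiedEven)
    (hDGZ : padicGrossZagier_nonsplitMult)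
    (hc : X2.CellB W p) (hns : ¬ W.HasSplitMultiplicativeReductionAtPrime p)
    {Φ₀ : AddSubgroup (geomTorsion W (p : ℤ))} (hΦ : IsRationalLine W p Φ₀)
    (hunr : LineUnramifiedAt W p Φ₀) (heven : LineEven W p Φ₀)
    {m : ℕ} [NeZero m] (φ : DirichletCharacter (ZMod p) m) {d : ℕ} [NeZero d]
    (ψ : DirichletCharacter (ZMod p) d) (hφ : φ.IsPrimitive) (hψ : ψ.IsPrimitive) (hpm : ¬ p ∣ m)
    (hpd : p ∣ d) (hquad : φ.IsQuadratic)
    (hφ0 : ∀ (σ : absoluteGaloisGroup ℚ), ∀ P ∈ Φ₀,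
      σ • P = (φ ((modNCyclotomicCharacter ℚ m σ : (ZMod m)ˣ) : ZMod m)).val • P)
    (hψ0 : ∀ (σ : absoluteGaloisGroup ℚ) (P : geomTorsion W (p : ℤ)),
      σ • P - (ψ ((modNCyclotomicCharacter ℚ d σ : (ZMod d)ˣ) : ZMod d)).val • P ∈ Φ₀)
    (S₀ : Finset (HeightOneSpectrum (𝓞 ℚ))) (hS₀p : ∀ v ∈ S₀, ((p : ℕ) : 𝓞 ℚ) ∉ v.asIdeal)
    (hS : ∀ v : HeightOneSpectrum (𝓞 ℚ), v ∉ S₀ → ((p : ℕ) : 𝓞 ℚ) ∉ v.asIdeal → W.HasGoodReductionAt v)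
    (hbal : 1 + ∑ v ∈ S₀, delta W p v =
      ∑ v ∈ S₀, ((if φ (Rat.HeightOneSpectrum.natGenerator v : ZMod m) =
            (Rat.HeightOneSpectrum.natGenerator v : ZMod p)
          then sFactor p (Rat.HeightOneSpectrum.natGenerator v) else 0) +
        (if ψ (Rat.HeightOneSpectrum.natGenerator v : ZMod d) =
            (Rat.HeightOneSpectrum.natGenerator v : ZMod p)
          then sFactor p (Rat.HeightOneSpectrum.natGenerator v) else 0)))
    (K : Type) [Field K] [NumberField K] (hK : IsImaginaryQuadratic K)
    (hHN : SatisfiesHeegnerHypothesis (W.conductorNorm ℤ) K) (hHp : SatisfiesHeegnerHypothesis p K)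
    (hoddK : Odd (NumberField.discr K)) (hlt : NumberField.discr K < -4)
    {N₀ : ℕ} (hHN₀ : SatisfiesHeegnerHypothesis N₀ K)
    (hS₀N₀ : ∀ v ∈ S₀, Rat.HeightOneSpectrum.natGenerator v ∣ N₀)
    (hmK : m.Coprime (NumberField.discr K).natAbs) (hdK : d.Coprime (NumberField.discr K).natAbs)
    (hh : ¬ p ∣ BinaryQuadraticForm.classNumber (-((m * (NumberField.discr K).natAbs : ℕ) : ℤ))) :
    ∃ (K : Type) (_ : Field K) (_ : NumberField K), IsImaginaryQuadratic K ∧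
      SatisfiesHeegnerHypothesis (W.conductorNorm ℤ) K ∧ SatisfiesHeegnerHypothesis p K ∧
      Odd (NumberField.discr K) ∧ NumberField.discr K < -4 ∧
      (W.quadraticTwist (NumberField.discr K : ℚ)).analyticRank = 1 ∧
      ∀ (Wd : WeierstrassCurve ℚ) [Wd.IsElliptic] [Wd.IsGloballyMinimal],
        (∃ C : VariableChange ℚ, C • Wd = W.quadraticTwist (NumberField.discr K : ℚ)) →
        MissingUpperBoundAt Wd p :=
  upperPartner_at_of_klFlat_partner_of_padicGZ hP hDis h311 hDGZ W p hc hns K hK hHN hHp hoddK hlt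
    (exists_klFlatCarrier_twist_of_unramifiedEven W p hc.2.1 hns hΦ hunr heven φ ψ hφ hψ hpm hpd hquad hφ0 hψ0 S₀
      hS₀p hS hbal K hK hHp (discr_emod_four_eq_one_of_odd hK.1 hoddK) hlt hHN₀ hS₀N₀ hmK hdK hh)

end Given

end Summit.BirchSwinnertonDyer.BirchSwinnertonDyer.Theorems.EisensteinPrimesMazurMCOnCellBTwistbackSubrowPartnerGivenPAdicGZ

end
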